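import Summits.Langlands.Langlands.Theorems.SqrtFiveQuarticCoversCertB3E7

/-!
# Route `Langlands/SqrtFiveQuarticCovers` — NF-E10-ZDS, part 2a: the `ℚ(√5)`-toolkit (kernel-checked)

Elementary lemmas for the kernel discharge of the named input NF-E10-ZDS of `CertB3E7` (sheet 4.5,
item stmt-Langlands-23416; cell `pub/lg-quartmod`, seat eng-7 g4).  Everything is folklore field
theory for a field `K ⊇ ℚ` of characteristic `0` containing `r` with `r² = 5` and an involution `σ`
whose fixed elements are exactly `a + b·r` (`a b : ℚ`):

* `exists_involution_fixing_sqrt_five` — for `K` quartic, such a `σ` exists with `σ ∘ σ = id`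
  (the file `…CertB3E7` has the same lemma without the involution clause);
* `eq_zero_of_rat_add_rat_mul_sqrt_five` — `1, r` are `ℚ`-linearly independent (`5` is not a square;
  `not_isSquare_nat_of_sqrt` is the `Nat.sqrt` test used for all «not a square» side conditions);
* `isSquare_or_of_sq_eq_ratCast` — `(a + b r)² = c ∈ ℚ` forces `c` or `5c` to be a rational square;
* `quadratic_ne_zero_of_not_isSquare` — an integer quadratic `αT²+βT+γ` with discriminant `Δ` has no
  root `a + b r` unless `Δ` or `5Δ` is a rational square;
* `exists_decomp_of_involution`, `false_of_sq_eq_add_mul` — for `w` with `σ w = −w`, `w² = d ∈ ℚˣ`,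
  every `z ∈ K` is `(a + b r) + (c + e r)·w`, and `y² = A + B·w` is impossible when
  `A² − dB² = M²` and none of `(A ± M)/2`, `5(A ± M)/2` is a rational square;
* `false_of_sum_eq_zero_of_homogeneous_mod` — the «no rational root» certificate: if the homogenised
  form of an integer polynomial has only the trivial zero over `𝔽_p`, the polynomial has no rational
  root (reduction of `n/d` in lowest terms).

HONEST STATUS: toolkit only; nothing here is a modularity statement.
-/

set_option linter.dupNamespace false -- project-wide option (lakefile weak.linter.dupNamespace); `Summit.Langlands.Langlands` is the mandated namespace

namespace Summit.Langlands.Langlands.Theorems.SqrtFiveQuarticCovers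

open scoped IntermediateField
open Polynomial

/-! ## 1. The involution of a quartic field over `ℚ(√5)` -/

/-- **The quadratic involution.**  For `K` a quartic number field and `r ∈ K` with `r² = 5` there
is a ring automorphism `σ ≠ id` of `K` with `σ r = r`, `σ ∘ σ = id`, and every element fixed by `σ`
is `a + b·r` with `a b : ℚ` (`K/ℚ(r)` is quadratic, hence Galois with group `{1, σ}`).  Same proof as
`exists_ringHom_ne_id_fixing_sqrt_five` of the `CertB3E7` file, recording in addition that `σ` has
order `2`. [folklore] -/
theorem exists_involution_fixing_sqrt_five {K : Type} [Field K] [NumberField K]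
    (hd : Module.finrank ℚ K = 4) {r : K} (hr : r ^ 2 = 5) :
    ∃ σ : K →+* K, σ r = r ∧ σ ≠ RingHom.id K ∧ (∀ z : K, σ (σ z) = z) ∧
      ∀ z : K, σ z = z → ∃ a b : ℚ, z = (a : K) + (b : K) * r := by
  have hr_int : IsIntegral ℚ r := Algebra.IsIntegral.isIntegral r
  have hF2 : Module.finrank ℚ ℚ⟮r⟯ = 2 := by
    rw [IntermediateField.adjoin.finrank hr_int, minpoly_eq_X_sq_sub_five hr, natDegree_X_pow_sub_C]
  have hFK : Module.finrank ℚ⟮r⟯ K = 2 := by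
    have h := Module.finrank_mul_finrank ℚ ℚ⟮r⟯ K
    rw [hF2, hd] at h
    omega
  haveI : Algebra.IsQuadraticExtension ℚ⟮r⟯ K := ⟨hFK⟩
  haveI : IsGalois ℚ⟮r⟯ K := inferInstance
  have hcard : Nat.card (K ≃ₐ[ℚ⟮r⟯] K) = 2 := by
    rw [IsGalois.card_aut_eq_finrank, hFK]
  obtain ⟨σ₀, hσ₀, huniq⟩ := (Nat.card_eq_two_iff' (1 : K ≃ₐ[ℚ⟮r⟯] K)).1 hcard
  have hall : ∀ g : K ≃ₐ[ℚ⟮r⟯] K, g = 1 ∨ g = σ₀ := fun g => by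
    by_cases hg : g = 1
    · exact Or.inl hg
    · exact Or.inr (huniq g hg)
  have hsq : σ₀ * σ₀ = 1 := by
    rcases hall (σ₀ * σ₀) with h | h
    · exact h
    · exact absurd (mul_left_cancel (a := σ₀) (h.trans (mul_one σ₀).symm)) hσ₀
  refine ⟨(σ₀ : K →+* K), ?_, ?_, ?_, ?_⟩
  · exact σ₀.commutes ⟨r, IntermediateField.mem_adjoin_simple_self ℚ r⟩
  · intro h
    apply hσ₀
    ext z
    exact congrArg (fun f : K →+* K => f z) h
  · intro z
    have h := congrArg (fun f : K ≃ₐ[ℚ⟮r⟯] K => f z) hsq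
    simpa [AlgEquiv.mul_apply] using h
  · intro z hz
    have hfix : ∀ f : K ≃ₐ[ℚ⟮r⟯] K, f z = z := by
      intro f
      rcases hall f with rfl | rfl
      · rfl
      · exact hz
    have hmem : z ∈ (⊥ : IntermediateField ℚ⟮r⟯ K) := (IsGalois.mem_bot_iff_fixed z).2 hfix
    rw [IntermediateField.mem_bot] at hmem
    obtain ⟨z', hz'⟩ := hmem
    obtain ⟨a, b, hab⟩ := exists_rat_add_rat_mul_of_mem_adjoin_sqrt_five hr z'.2
    refine ⟨a, b, ?_⟩
    rw [← hz', ← hab]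
    rfl

/-! ## 2. `ℚ`-linear independence of `1, r` and square classes in `ℚ(r)` -/

/-- A natural number `x` with `⌊√x⌋² ≠ x` is not a square (use with `norm_num` for `Nat.sqrt`).
[folklore] -/
theorem not_isSquare_nat_of_sqrt {x s : ℕ} (hs : Nat.sqrt x = s) (hx : s * s ≠ x) : ¬ IsSquare x := by
  rintro ⟨n, hn⟩
  have h := Nat.sqrt_eq' n
  rw [sq, ← hn, hs] at h
  exact hx (by rw [h]; exact hn.symm)

/-- `1` and `r` (`r² = 5`) are linearly independent over `ℚ`: `a + b·r = 0 ⇒ a = b = 0`. [folklore] -/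
theorem eq_zero_of_rat_add_rat_mul_sqrt_five {K : Type} [Field K] [CharZero K] {r : K}
    (hr : r ^ 2 = 5) {a b : ℚ} (h : (a : K) + (b : K) * r = 0) : a = 0 ∧ b = 0 := by
  by_cases hb : b = 0
  · subst hb
    refine ⟨?_, rfl⟩
    have : ((a : ℚ) : K) = 0 := by simpa using h
    exact_mod_cast this
  · exfalso
    -- `5` is not a rational square (cf. `Literature…curve480a1.not_isSquare_five`, not imported here)
    have h5 : ¬ IsSquare (5 : ℚ) := by
      rw [show (5 : ℚ) = ((5 : ℕ) : ℚ) by norm_num, Rat.isSquare_natCast_iff]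
      exact not_isSquare_nat_of_sqrt (s := 2) (by norm_num) (by norm_num)
    apply h5
    have hbK : (b : K) ≠ 0 := by exact_mod_cast hb
    have hr' : r = (((-a / b : ℚ)) : K) := by
      push_cast
      field_simp
      linear_combination h
    refine ⟨-a / b, ?_⟩
    have h5 : (((-a / b) * (-a / b) : ℚ) : K) = ((5 : ℚ) : K) := by
      push_cast
      rw [← sq]
      push_cast at hr'
      rw [← hr', hr]
    exact (Rat.cast_injective h5).symm

/-- If `(a + b·r)² = c` with `a b c : ℚ` (`r² = 5`) then `c` or `5c` is a rational square. [folklore] -/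
theorem isSquare_or_of_sq_eq_ratCast {K : Type} [Field K] [CharZero K] {r : K} (hr : r ^ 2 = 5)
    {a b c : ℚ} (h : ((a : K) + (b : K) * r) ^ 2 = (c : K)) : IsSquare c ∨ IsSquare (5 * c) := by
  have h' : ((a ^ 2 + 5 * b ^ 2 - c : ℚ) : K) + ((2 * a * b : ℚ) : K) * r = 0 := by
    push_cast
    linear_combination h - (b : K) ^ 2 * hr
  obtain ⟨h1, h2⟩ := eq_zero_of_rat_add_rat_mul_sqrt_five hr h'
  rcases mul_eq_zero.1 (show a * b = 0 by linarith) with ha | hb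
  · right
    exact ⟨5 * b, by rw [ha] at h1; linarith⟩
  · left
    exact ⟨a, by rw [hb] at h1; linarith⟩

/-- An integer quadratic `αT² + βT + γ` (discriminant `Δ = β² − 4αγ`) has no root of the
form `a + b·r` (`a b : ℚ`, `r² = 5`) unless `Δ` or `5Δ` is a rational square. [folklore] -/
theorem quadratic_ne_zero_of_not_isSquare {K : Type} [Field K] [CharZero K] {r : K} (hr : r ^ 2 = 5)
    (α β γ : ℤ) (hΔ : ¬ IsSquare ((β ^ 2 - 4 * α * γ : ℤ) : ℚ))
    (hΔ5 : ¬ IsSquare ((5 * (β ^ 2 - 4 * α * γ) : ℤ) : ℚ)) (a b : ℚ) :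
    (α : K) * ((a : K) + (b : K) * r) ^ 2 + (β : K) * ((a : K) + (b : K) * r) + (γ : K) ≠ 0 := by
  intro h
  have h' : ((α * (a ^ 2 + 5 * b ^ 2) + β * a + γ : ℚ) : K) + ((b * (2 * α * a + β) : ℚ) : K) * r
      = 0 := by
    push_cast
    linear_combination h - (α : K) * (b : K) ^ 2 * hr
  obtain ⟨h1, h2⟩ := eq_zero_of_rat_add_rat_mul_sqrt_five hr h'
  rcases mul_eq_zero.1 h2 with hb | hl
  · apply hΔ
    refine ⟨2 * α * a + β, ?_⟩
    push_cast
    rw [hb] at h1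
    linear_combination -4 * (α : ℚ) * h1
  · apply hΔ5
    refine ⟨10 * α * b, ?_⟩
    push_cast
    linear_combination (-20 * (α : ℚ)) * h1 + (5 * (2 * (α : ℚ) * a + β)) * hl

/-! ## 3. Decomposition along an anti-invariant square root and the `y² = A + B·w` obstruction -/

/-- For an involution `σ` with fixed elements `a + b·r` and an element `w` with `σ w = −w`,
`w² = d ∈ ℚ`, `d ≠ 0`: every `z ∈ K` is `(a + b·r) + (c + e·r)·w`. [folklore] -/
theorem exists_decomp_of_involution {K : Type} [Field K] [CharZero K] {r : K}
    {σ : K →+* K} (hσσ : ∀ z : K, σ (σ z) = z)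
    (hfix : ∀ z : K, σ z = z → ∃ a b : ℚ, z = (a : K) + (b : K) * r)
    {w : K} (hw : σ w = -w) {d : ℚ} (hd : d ≠ 0) (hwd : w ^ 2 = (d : K)) (z : K) :
    ∃ a b c e : ℚ, z = ((a : K) + (b : K) * r) + ((c : K) + (e : K) * r) * w := by
  have hwne : w ≠ 0 := by
    rintro rfl
    apply hd
    have : ((d : ℚ) : K) = 0 := by rw [← hwd]; ring
    exact_mod_cast this
  obtain ⟨a, b, hab⟩ := hfix (z + σ z) (by rw [map_add, hσσ, add_comm])
  obtain ⟨c, e, hce⟩ := hfix ((z - σ z) * w) (by rw [map_mul, map_sub, hσσ, hw]; ring)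
  refine ⟨a / 2, b / 2, c / (2 * d), e / (2 * d), ?_⟩
  have hdK : (d : K) ≠ 0 := by exact_mod_cast hd
  have h2d : (2 * (d : K)) ≠ 0 := mul_ne_zero two_ne_zero hdK
  have key : 2 * (d : K) * z = (d : K) * (z + σ z) + ((z - σ z) * w) * w := by
    rw [mul_assoc (z - σ z), ← sq, hwd]; ring
  rw [hab, hce] at key
  have ha' : ((a / 2 : ℚ) : K) * 2 = a := by push_cast; ring
  have hb' : ((b / 2 : ℚ) : K) * 2 = b := by push_cast; ring
  have hc' : ((c / (2 * d) : ℚ) : K) * (2 * (d : K)) = c := by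
    rw [Rat.cast_div, Rat.cast_mul, Rat.cast_ofNat]; exact div_mul_cancel₀ _ h2d
  have he' : ((e / (2 * d) : ℚ) : K) * (2 * (d : K)) = e := by
    rw [Rat.cast_div, Rat.cast_mul, Rat.cast_ofNat]; exact div_mul_cancel₀ _ h2d
  refine mul_left_cancel₀ h2d ?_
  linear_combination key - (d : K) * ha' - (d : K) * r * hb' - w * hc' - r * w * he'

/-- **The `y² = A + B·w` obstruction.**  With `σ`, `r`, `w`, `d` as in
`exists_decomp_of_involution` (and `σ r = r`): if `M² = A² − d·B²` and none of `(A+M)/2`,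
`5(A+M)/2`, `(A−M)/2`, `5(A−M)/2` is a rational square, then no `y ∈ K` has `y² = A + B·w`.
(Writing `y = α + β w` with `α, β ∈ ℚ(r)`: `α² + dβ² = A`, `2αβ = B`, so `(α² − dβ²)² = M²` and
`α² = (A ± M)/2 ∈ ℚ(r)²`.) [folklore] -/
theorem false_of_sq_eq_add_mul {K : Type} [Field K] [CharZero K] {r : K} (hr : r ^ 2 = 5)
    {σ : K →+* K} (hσr : σ r = r) (hσσ : ∀ z : K, σ (σ z) = z)
    (hfix : ∀ z : K, σ z = z → ∃ a b : ℚ, z = (a : K) + (b : K) * r)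
    {w : K} (hw : σ w = -w) {d : ℚ} (hd : d ≠ 0) (hwd : w ^ 2 = (d : K))
    (A B M : ℚ) (hM : M ^ 2 = A ^ 2 - d * B ^ 2)
    (h₁ : ¬ IsSquare ((A + M) / 2)) (h₁' : ¬ IsSquare (5 * ((A + M) / 2)))
    (h₂ : ¬ IsSquare ((A - M) / 2)) (h₂' : ¬ IsSquare (5 * ((A - M) / 2)))
    {y : K} (hy : y ^ 2 = (A : K) + (B : K) * w) : False := by
  obtain ⟨a, b, c, e, hy'⟩ := exists_decomp_of_involution hσσ hfix hw hd hwd y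
  set α : K := (a : K) + (b : K) * r with hα
  set β : K := (c : K) + (e : K) * r with hβ
  have hσα : σ α = α := by rw [hα, map_add, map_mul, map_ratCast, map_ratCast, hσr]
  have hσβ : σ β = β := by rw [hβ, map_add, map_mul, map_ratCast, map_ratCast, hσr]
  -- `y² = (α² + dβ²) + (2αβ)·w`; compare with `A + B w` using `w ∉ ℚ(r)`
  have hP : (α ^ 2 + (d : K) * β ^ 2 - A) + (2 * α * β - B) * w = 0 := by
    rw [hy'] at hy
    linear_combination hy - β ^ 2 * hwd
  have hQ : 2 * α * β - B = 0 := by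
    by_contra hne
    -- apply `σ`: the coefficients are fixed, so `(2αβ − B)(σ w − w) = 0`, i.e. `σ w = w = −w`
    have hσP : (α ^ 2 + (d : K) * β ^ 2 - A) + (2 * α * β - B) * σ w = 0 := by
      have h := congrArg σ hP
      simp only [map_add, map_sub, map_mul, map_pow, map_ratCast, map_ofNat, map_zero, hσα,
        hσβ] at h
      exact h
    have hprod : (2 * α * β - B) * (σ w - w) = 0 := by linear_combination hσP - hP
    rcases mul_eq_zero.1 hprod with h0 | h0
    · exact hne h0
    · have hw0 : w = 0 := by
        have h2 : (2 : K) * w = 0 := by linear_combination hw - h0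
        simpa using h2
      apply hd
      have : ((d : ℚ) : K) = 0 := by rw [← hwd, hw0]; ring
      exact_mod_cast this
  have hR : α ^ 2 + (d : K) * β ^ 2 - A = 0 := by
    have h := hP
    rw [hQ, zero_mul, add_zero] at h
    exact h
  have key : (α ^ 2 - (d : K) * β ^ 2) ^ 2 = ((M : ℚ) : K) ^ 2 := by
    have hMK : ((M : ℚ) : K) ^ 2 = (A : K) ^ 2 - (d : K) * (B : K) ^ 2 := by
      have h := congrArg (fun q : ℚ => (q : K)) hM
      push_cast at h
      exact h
    rw [hMK]
    linear_combination (α ^ 2 + (d : K) * β ^ 2 + A) * hR - (d : K) * (2 * α * β + B) * hQ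
  -- so `α² = (A ± M)/2`
  have hcases : α ^ 2 = (((A + M) / 2 : ℚ) : K) ∨ α ^ 2 = (((A - M) / 2 : ℚ) : K) := by
    rcases sq_eq_sq_iff_eq_or_eq_neg.1 key with h | h
    · left; push_cast; linear_combination (h + hR) / 2
    · right; push_cast; linear_combination (h + hR) / 2
  rcases hcases with h | h
  · rcases isSquare_or_of_sq_eq_ratCast hr (a := a) (b := b) (by rw [← hα]; exact h) with hs | hs
    · exact h₁ hs
    · exact h₁' hs
  · rcases isSquare_or_of_sq_eq_ratCast hr (a := a) (b := b) (by rw [← hα]; exact h) with hs | hs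
    · exact h₂ hs
    · exact h₂' hs

/-! ## 4. «No rational root» from a homogeneous certificate modulo `p` -/

/-- **No rational root, certified mod `p`.**  Let `F(u,v) = Σᵢ cᵢ uⁱ v^{N−i}` be the homogenisation
of `f(T) = Σᵢ cᵢ Tⁱ ∈ ℤ[T]`.  If `F` has only the trivial zero over `𝔽_p`, then `f` has no rational
root: for `a = n/d` in lowest terms `F(n,d) = dᴺ f(a) = 0`, so `p ∣ n` and `p ∣ d`. [folklore] -/
theorem false_of_sum_eq_zero_of_homogeneous_mod (p : ℕ) [hp : Fact p.Prime] (N : ℕ)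
    (c : Fin (N + 1) → ℤ)
    (hmod : ∀ u v : ZMod p,
      (∑ i : Fin (N + 1), ((c i : ℤ) : ZMod p) * u ^ (i : ℕ) * v ^ (N - (i : ℕ))) = 0 → u = 0 ∧ v = 0)
    (a : ℚ) (h : (∑ i : Fin (N + 1), ((c i : ℤ) : ℚ) * a ^ (i : ℕ)) = 0) : False := by
  set n : ℤ := a.num with hn
  set d : ℕ := a.den with hdd
  have hd0 : (d : ℚ) ≠ 0 := by exact_mod_cast a.den_nz
  have ha : a = (n : ℚ) / (d : ℚ) := (Rat.num_div_den a).symm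
  -- the integer identity `Σ cᵢ nⁱ d^{N-i} = 0`
  have hZ : (∑ i : Fin (N + 1), c i * n ^ (i : ℕ) * (d : ℤ) ^ (N - (i : ℕ))) = 0 := by
    have hQ : ((∑ i : Fin (N + 1), c i * n ^ (i : ℕ) * (d : ℤ) ^ (N - (i : ℕ)) : ℤ) : ℚ)
        = (d : ℚ) ^ N * ∑ i : Fin (N + 1), ((c i : ℤ) : ℚ) * a ^ (i : ℕ) := by
      push_cast
      rw [Finset.mul_sum]
      refine Finset.sum_congr rfl fun i _ => ?_
      have hi : (i : ℕ) ≤ N := Nat.lt_succ_iff.1 i.isLt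
      rw [ha, div_pow]
      have hsplit : (d : ℚ) ^ N = (d : ℚ) ^ (i : ℕ) * (d : ℚ) ^ (N - (i : ℕ)) := by
        rw [← pow_add, Nat.add_sub_cancel' hi]
      rw [hsplit]
      field_simp
    rw [h, mul_zero] at hQ
    exact_mod_cast hQ
  have hP : (∑ i : Fin (N + 1), ((c i : ℤ) : ZMod p) * ((n : ℤ) : ZMod p) ^ (i : ℕ)
      * (((d : ℤ) : ℤ) : ZMod p) ^ (N - (i : ℕ))) = 0 := by
    have := congrArg (Int.cast : ℤ → ZMod p) hZ
    push_cast at this ⊢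
    exact this
  obtain ⟨hn0, hd0'⟩ := hmod _ _ hP
  have hpn : (p : ℤ) ∣ n := (ZMod.intCast_zmod_eq_zero_iff_dvd n p).1 hn0
  have hpd : p ∣ d := by
    have : ((d : ℕ) : ZMod p) = 0 := by exact_mod_cast hd0'
    exact (ZMod.natCast_eq_zero_iff d p).1 this
  have hcop : Nat.Coprime n.natAbs d := a.reduced
  have hpn' : p ∣ n.natAbs := Int.natAbs_dvd_natAbs.2 hpn |>.trans (by simp)
  have : p ∣ Nat.gcd n.natAbs d := Nat.dvd_gcd hpn' hpd
  rw [hcop] at this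
  exact hp.out.one_lt.ne' (Nat.dvd_one.1 this)

end Summit.Langlands.Langlands.Theorems.SqrtFiveQuarticCovers
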